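import Literature.AlgebraicGeometry.Resolution.AlterationsSemiStable
import Mathlib.RingTheory.AdicCompletion.Noetherian
import Mathlib.RingTheory.PowerSeries.Basic
import Mathlib.RingTheory.PowerSeries.Inverse
import Mathlib.Data.Finsupp.Antidiagonal
import HarnessLib

/-!
# The local ring of an ordinary double point is reduced (de Jong 1996, 2.21/2.23; Liu 2002, 7.5.13)

Topic: `Literature/AlgebraicGeometry/Resolution`. API for the ordinary double points of
`AlterationsSemiStable.lean` (`IsOrdinaryDoublePoint K x`: the completed local ring `𝒪̂_{C,x}`
is isomorphic to `K⟦u, v⟧/(uv)`, de Jong 1996, 2.23), first step of the proof that the fibres of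
a semi-stable curve (loc. cit. 2.21: "all geometric fibres are connected curves having at most
ordinary double points as singularities") are REDUCED curves — the input of the normality /
`codim(Sing(X), X) ≥ 2` remark of loc. cit. 3.4 (`DeJong1996SemiStableSingCodimTwo`,
`AlterationsSemiStableCodimTwo.lean`):

* `MvPowerSeries.axisSeries t` — the ring homomorphism `K⟦x₀, x₁⟧ → K⟦X⟧` keeping the monomials
  in the single variable `x_t` (i.e. setting the other variable to `0`), with
  `X s ∣ φ ↔ axisSeries t φ = 0` for `s ≠ t` (`MvPowerSeries.X_dvd_iff`);
* `MvPowerSeries.X_mul_X_dvd_of_dvd_of_dvd`, `MvPowerSeries.isRadical_span_X_mul_X`,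
  `MvPowerSeries.isReduced_quotient_span_X_mul_X` — over a domain (e.g. a field) the ideal
  `(x₀ x₁) ⊂ K⟦x₀, x₁⟧` is radical: **`K⟦u, v⟧/(uv)` is reduced** (the two branches `u = 0`,
  `v = 0` of the node are reduced and `(u) ∩ (v) = (uv)`);
* `IsOrdinaryDoublePoint.isReduced` — **the (Noetherian) local ring of an ordinary double point is
  reduced**: it embeds into its completion (Krull's intersection theorem, Mathlib
  `AdicCompletion.of_injective`), which is `K⟦u, v⟧/(uv)`.

Everything is proved; statements are folklore (Liu 2002, 7.5.13–7.5.14 discusses ordinary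
multiple points through the completion; de Jong 1996, 2.21 calls the fibres "curves", i.e.
reduced).

## Sources

* A. J. de Jong, *Smoothness, semi-stability and alterations*, Publ. Math. IHÉS 83 (1996),
  2.21–2.23 (pp. 61–62), 3.4 (p. 63).
-/

noncomputable section

open IsLocalRing AlgebraicGeometry

namespace Literature.AlgebraicGeometry.Resolution

universe u

/-! ## Setting one of two variables to zero -/

namespace MvPowerSeries

open _root_.MvPowerSeries

variable {R : Type*} [CommSemiring R]

/-- A finitely supported function on `Fin 2` vanishing at `s ≠ t` is `single t` of its value at
`t`. [folklore] -/
theorem _root_.Finsupp.eq_single_of_fin_two {s t : Fin 2} (hst : s ≠ t) (m : Fin 2 →₀ ℕ)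
    (hm : m s = 0) : m = Finsupp.single t (m t) := by
  ext i
  by_cases hi : i = t
  · subst hi
    simp
  · have his : i = s := by
      fin_cases i <;> fin_cases s <;> fin_cases t <;> simp_all
    subst his
    rw [hm, Finsupp.single_apply, if_neg (Ne.symm hi)]

/-- **Setting the other variable to zero**: the map `R⟦x₀, x₁⟧ → R⟦X⟧` keeping only the
monomials `x_t^j ↦ X^j` (the composite `R⟦x₀, x₁⟧ → R⟦x₀, x₁⟧/(x_s) ≅ R⟦x_t⟧`, `s ≠ t`), as a
ring homomorphism. [folklore] -/
def axisSeries (t : Fin 2) : MvPowerSeries (Fin 2) R →+* PowerSeries R where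
  toFun φ := PowerSeries.mk fun j => coeff (Finsupp.single t j) φ
  map_one' := by
    ext j
    rw [PowerSeries.coeff_mk, coeff_one, PowerSeries.coeff_one]
    by_cases hj : j = 0
    · subst hj
      simp
    · rw [if_neg, if_neg hj]
      intro h
      apply hj
      have := congrArg (fun m : Fin 2 →₀ ℕ => m t) h
      simpa using this
  map_mul' φ ψ := by
    classical
    ext j
    rw [PowerSeries.coeff_mk, coeff_mul, PowerSeries.coeff_mul, Finsupp.antidiagonal_single,
      Finset.sum_map]
    refine Finset.sum_congr rfl fun p _ => ?_
    simp [PowerSeries.coeff_mk]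
  map_zero' := by
    ext j
    simp
  map_add' φ ψ := by
    ext j
    simp

/-- The coefficients of `axisSeries t φ`. [folklore] -/
@[simp] theorem coeff_axisSeries (t : Fin 2) (φ : MvPowerSeries (Fin 2) R) (j : ℕ) :
    PowerSeries.coeff j (axisSeries t φ) = coeff (Finsupp.single t j) φ := by
  simp [axisSeries]

/-- `axisSeries t` sends the kept variable `x_t` to `X`. [folklore] -/
@[simp] theorem axisSeries_X_self (t : Fin 2) :
    axisSeries t (X t : MvPowerSeries (Fin 2) R) = PowerSeries.X := by
  ext j
  rw [coeff_axisSeries, coeff_X, PowerSeries.coeff_X]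
  by_cases hj : j = 1
  · subst hj
    simp
  · rw [if_neg, if_neg hj]
    intro h
    apply hj
    have := congrArg (fun m : Fin 2 →₀ ℕ => m t) h
    simpa using this

/-- **Divisibility by a variable is vanishing on the other axis**: for `s ≠ t`,
`x_s ∣ φ ↔ axisSeries t φ = 0` (`MvPowerSeries.X_dvd_iff`: `x_s ∣ φ` iff all coefficients of
monomials not involving `x_s` vanish). [folklore] -/
theorem X_dvd_iff_axisSeries_eq_zero {s t : Fin 2} (hst : s ≠ t) (φ : MvPowerSeries (Fin 2) R) :
    (X s : MvPowerSeries (Fin 2) R) ∣ φ ↔ axisSeries t φ = 0 := by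
  rw [X_dvd_iff]
  constructor
  · intro h
    ext j
    rw [coeff_axisSeries, map_zero]
    exact h _ (by rw [Finsupp.single_apply, if_neg (Ne.symm hst)])
  · intro h m hm
    rw [Finsupp.eq_single_of_fin_two hst m hm, ← coeff_axisSeries, h, map_zero]

end MvPowerSeries

/-! ## `K⟦u, v⟧/(uv)` is reduced -/

namespace MvPowerSeries

open _root_.MvPowerSeries

variable {R : Type*} [CommRing R] [IsDomain R]

/-- `(x₀) ∩ (x₁) = (x₀ x₁)` in `R⟦x₀, x₁⟧` (`R` a domain): if both variables divide
`φ` then so does their product — write `φ = x_s φ₁`; on the `x_s`-axis `x_t ∣ x_s φ₁` reads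
`X · axisSeries s φ₁ = 0`, so `x_t ∣ φ₁`. [folklore] -/
theorem X_mul_X_dvd_of_dvd_of_dvd {s t : Fin 2} (hst : s ≠ t) {φ : MvPowerSeries (Fin 2) R}
    (hs : (X s : MvPowerSeries (Fin 2) R) ∣ φ) (ht : (X t : MvPowerSeries (Fin 2) R) ∣ φ) :
    (X s * X t : MvPowerSeries (Fin 2) R) ∣ φ := by
  obtain ⟨φ₁, rfl⟩ := hs
  refine mul_dvd_mul_left _ ((X_dvd_iff_axisSeries_eq_zero (Ne.symm hst) φ₁).mpr ?_)
  have h := (X_dvd_iff_axisSeries_eq_zero (Ne.symm hst) _).mp ht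
  rw [map_mul, axisSeries_X_self] at h
  exact (mul_eq_zero.mp h).resolve_left PowerSeries.X_ne_zero

/-- A variable dividing a power divides the element: `x_s ∣ φⁿ → x_s ∣ φ` (`R` a domain: on the
other axis `(axisSeries t φ)ⁿ = 0` forces `axisSeries t φ = 0`, `R⟦X⟧` being reduced).
[folklore] -/
theorem X_dvd_of_X_dvd_pow {s t : Fin 2} (hst : s ≠ t) {φ : MvPowerSeries (Fin 2) R} {n : ℕ}
    (h : (X s : MvPowerSeries (Fin 2) R) ∣ φ ^ n) : (X s : MvPowerSeries (Fin 2) R) ∣ φ := by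
  rw [X_dvd_iff_axisSeries_eq_zero hst] at h ⊢
  rw [map_pow] at h
  exact IsReduced.eq_zero _ ⟨n, h⟩

/-- **The ideal `(x₀ x₁) ⊂ R⟦x₀, x₁⟧` is radical** (`R` a domain, e.g. a field). [folklore] -/
theorem isRadical_span_X_mul_X :
    (Ideal.span {(X 0 * X 1 : MvPowerSeries (Fin 2) R)}).IsRadical := by
  rintro φ ⟨n, hn⟩
  rw [Ideal.mem_span_singleton] at hn ⊢
  have h01 : (0 : Fin 2) ≠ 1 := by decide
  exact X_mul_X_dvd_of_dvd_of_dvd h01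
    (X_dvd_of_X_dvd_pow h01 (dvd_trans (dvd_mul_right _ _) hn))
    (X_dvd_of_X_dvd_pow (Ne.symm h01) (dvd_trans (dvd_mul_left _ _) hn))

/-- **`K⟦u, v⟧/(uv)` is reduced** — the complete local ring of an ordinary double point
(de Jong 1996, 2.23) has no nilpotents (`K` any domain). [cite: DeJong1996, 2.23, pp. 61–62] -/
instance isReduced_quotient_span_X_mul_X :
    IsReduced (MvPowerSeries (Fin 2) R ⧸
      Ideal.span {(X 0 * X 1 : MvPowerSeries (Fin 2) R)}) :=
  (Ideal.isRadical_iff_quotient_reduced _).mp isRadical_span_X_mul_X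

end MvPowerSeries

/-! ## The local ring of an ordinary double point is reduced -/

namespace IsOrdinaryDoublePoint

variable {K : Type u} [Field K] {C : Scheme.{u}} {x : C}

/-- **The local ring of an ordinary double point is reduced**: a Noetherian local ring embeds
into its completion (Krull's intersection theorem; Mathlib `AdicCompletion.of_injective`), and
the completion `K⟦u, v⟧/(uv)` is reduced. (The local rings of a scheme locally of finite type
over a field — e.g. a geometric fibre of a semi-stable curve, de Jong 1996, 2.21 — are
Noetherian.) [cite: DeJong1996, 2.21–2.23, pp. 61–62] -/
theorem isReduced [IsNoetherianRing (C.presheaf.stalk x)] (h : IsOrdinaryDoublePoint K x) :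
    _root_.IsReduced (C.presheaf.stalk x) := by
  obtain ⟨e⟩ := h
  set A := (C.presheaf.stalk x : Type u)
  -- the ring map `A → Â ≅ K⟦u,v⟧/(uv)` is injective
  let ι : A →+* _ := e.toRingHom.comp (algebraMap A (AdicCompletion (maximalIdeal A) A))
  have hι : Function.Injective ι := by
    refine e.injective.comp ?_
    exact AdicCompletion.of_injective (maximalIdeal A) A
  exact isReduced_of_injective ι hι

end IsOrdinaryDoublePoint

end Literature.AlgebraicGeometry.Resolution

end
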